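import Mathlib
import Summits.ValiantsHypothesis.ValiantsHypothesis.Theorems.RigidityForcesSymmetryRankRigidMinimalReprLaplaceFiveSeparatedCaptureCommonLineRows
import Summits.ValiantsHypothesis.ValiantsHypothesis.Theorems.RigidityForcesSymmetryRankRigidMinimalReprLaplaceFiveSeparatedCaptureCommonLineAllBinary
import Summits.ValiantsHypothesis.ValiantsHypothesis.Theorems.RigidityForcesSymmetryRankRigidMinimalReprLaplaceFiveSeparatedCaptureLinesK1

/-!
# ValiantsHypothesis / RigidityForcesSymmetry — crux `LaplaceOptimalFive` (stmt-ValiantsHypothesis-24813), symmetric capture: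
# ★★★ **`CaptureIneqSym` FOR THREE PLANES THROUGH A ZERO-DIAGONAL COMMON LINE WITH THREE NONZERO ROWS** (assembly)

Brick 3 (part 10) of the K1 lane (val-port-2 g6, 2026-08-29).  Case split on the prolongation finranks of `⟨u,a⟩ ⊔ ⟨u,b⟩` and
`⟨u,a⟩ ⊔ ⟨u,c⟩`: if one is ≤ 3, ✓ `finrank_le_six_of_common_line_rows` (with ✓ `contractZ_mem_L3_swap23` for the second); if both are
≥ 4, ✓ `finrank_le_five_of_common_line_two_binary_pairs`.  Together with ✓ `captureIneqSym_of_common_line_diag` (a diagonal entry) this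
settles `CaptureIneqSym` for every triple of symmetric 2-planes through a common line `u` EXCEPT the pair-monomial line `u = x_i x_j`
(zero-diagonal with exactly two nonzero rows), which stays located (`W ≤ 5 + r`, (R1); census 62 776/0 covered by the six typed leaves).

* ★★★ `finrank_le_six_of_common_line_three_rows`, ★★★ `captureIneqSym_of_common_line_three_rows`.
* ★★ `finrank_le_four_add_prolong_of_common_line` (any zero-diagonal common line: `W ≤ 4 + p(U₀₁ ⊔ U₀₂)`), ★ `captureIneqSym_of_common_line_of_prolong_le_two`
  — so for the pair-monomial line the located residue is exactly «all three pairwise prolongations ≥ 3».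

Honest framing.  `CaptureIneqSym` for three arbitrary planes through a pair-monomial line, `CaptureIneqSym` in general, K1 on
`K₃ ⊔ K₂`, `LaplaceOptimalFive` (OPEN · CONTESTED 72/120), `RankRigidMinimalRepr` and `VP ≠ VNP` are NOT proved here.  No definitions,
no `sorry`.
-/

set_option linter.dupNamespace false
set_option autoImplicit false

namespace Summit.ValiantsHypothesis.ValiantsHypothesis.Theorems.RigidityForcesSymmetryRankRigidMinimalRepr

namespace LaplaceFiveSeparatedCapture

open Finset

/-- ★★★ **`CaptureIneqSym` FOR A ZERO-DIAGONAL COMMON LINE WITH THREE NONZERO ROWS: `finrank W ≤ 6`.**  `u` symmetric zero-diagonal with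
an entry `u_{ij} ≠ 0` and a third nonzero row `p ∉ {i,j}`; `a, b, c` symmetric with `a ∉ ⟨u,b⟩`, `a ∉ ⟨u,c⟩`; every `W` of symmetric
zero-diagonal leaf matrices captured by `L3 ⟨u,a⟩ ⟨u,b⟩ ⟨u,c⟩` has `finrank W ≤ 6` (case split on the prolongation finranks of
`⟨u,a⟩ ⊔ ⟨u,b⟩` and `⟨u,a⟩ ⊔ ⟨u,c⟩`: ✓ `finrank_le_six_of_common_line_rows` if one is ≤ 3, ✓ `finrank_le_five_of_common_line_two_binary_pairs`
if both are ≥ 4). [folklore] -/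
theorem finrank_le_six_of_common_line_three_rows (u a b c : Fin 5 → Fin 5 → ℂ) (hu : ∀ p q, u p q = u q p)
    (ha : ∀ p q, a p q = a q p) (hb : ∀ p q, b p q = b q p) (hc : ∀ p q, c p q = c q p)
    (i j p r : Fin 5) (hij : i ≠ j) (hpi : p ≠ i) (hpj : p ≠ j) (huij : u i j ≠ 0) (hupr : u p r ≠ 0) (hud : ∀ q, u q q = 0)
    (hab : a ∉ Submodule.span ℂ ({u, b} : Set (Fin 5 → Fin 5 → ℂ))) (hac : a ∉ Submodule.span ℂ ({u, c} : Set (Fin 5 → Fin 5 → ℂ)))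
    (W : Submodule ℂ (Fin 5 → Fin 5 → ℂ))
    (hWs : ∀ μ ∈ W, ∀ s t : Fin 5, μ s t = μ t s) (hWd : ∀ μ ∈ W, ∀ s : Fin 5, μ s s = 0)
    (hWc : ∀ μ ∈ W, contractZ μ ∈ L3 (Submodule.span ℂ ({u, a} : Set (Fin 5 → Fin 5 → ℂ)))
      (Submodule.span ℂ ({u, b} : Set (Fin 5 → Fin 5 → ℂ))) (Submodule.span ℂ ({u, c} : Set (Fin 5 → Fin 5 → ℂ)))) :
    Module.finrank ℂ W ≤ 6 := by
  classical
  have hsym2 : ∀ v : Fin 5 → Fin 5 → ℂ, (∀ p q, v p q = v q p) →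
      ∀ x ∈ Submodule.span ℂ ({u, v} : Set (Fin 5 → Fin 5 → ℂ)), ∀ p q : Fin 5, x p q = x q p := by
    intro v hv x hx p q
    obtain ⟨c1, c2, rfl⟩ := Submodule.mem_span_pair.mp hx
    simp only [Pi.add_apply, Pi.smul_apply, smul_eq_mul, hu p q, hv p q]
  have hub : u ∈ Submodule.span ℂ ({u, b} : Set (Fin 5 → Fin 5 → ℂ)) := Submodule.subset_span (by simp)
  have huc : u ∈ Submodule.span ℂ ({u, c} : Set (Fin 5 → Fin 5 → ℂ)) := Submodule.subset_span (by simp)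
  by_cases h12 : Module.finrank ℂ (prolong (Submodule.span ℂ ({u, a} : Set (Fin 5 → Fin 5 → ℂ)) ⊔
      Submodule.span ℂ ({u, b} : Set (Fin 5 → Fin 5 → ℂ)))) ≤ 3
  · exact finrank_le_six_of_common_line_rows u a c hu ha hc i j p r hij hpi hpj huij hupr hud _ W (hsym2 b hb) hub hab h12
      hWs hWd hWc
  by_cases h13 : Module.finrank ℂ (prolong (Submodule.span ℂ ({u, a} : Set (Fin 5 → Fin 5 → ℂ)) ⊔
      Submodule.span ℂ ({u, c} : Set (Fin 5 → Fin 5 → ℂ)))) ≤ 3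
  · have hWc' : ∀ μ ∈ W, contractZ μ ∈ L3 (Submodule.span ℂ ({u, a} : Set (Fin 5 → Fin 5 → ℂ)))
        (Submodule.span ℂ ({u, c} : Set (Fin 5 → Fin 5 → ℂ))) (Submodule.span ℂ ({u, b} : Set (Fin 5 → Fin 5 → ℂ))) :=
      fun μ hμ => contractZ_mem_L3_swap23 _ _ _ (hsym2 a ha) μ (hWc μ hμ)
    exact finrank_le_six_of_common_line_rows u a b hu ha hb i j p r hij hpi hpj huij hupr hud _ W (hsym2 c hc) huc hac h13
      hWs hWd hWc'
  push Not at h12 h13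
  exact (finrank_le_five_of_common_line_two_binary_pairs u a b c hu ha hb hc i j huij hud hab (by omega) (by omega) W
    hWs hWd hWc).trans (by norm_num)


/-- ★★★ **`CaptureIneqSym` for three 2-planes through a zero-diagonal common line with three nonzero rows** (`6 ≤ Σ finrank`). [folklore] -/
theorem captureIneqSym_of_common_line_three_rows (u a b c : Fin 5 → Fin 5 → ℂ) (hu : ∀ p q, u p q = u q p)
    (ha : ∀ p q, a p q = a q p) (hb : ∀ p q, b p q = b q p) (hc : ∀ p q, c p q = c q p)
    (i j p r : Fin 5) (hij : i ≠ j) (hpi : p ≠ i) (hpj : p ≠ j) (huij : u i j ≠ 0) (hupr : u p r ≠ 0) (hud : ∀ q, u q q = 0)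
    (hab : a ∉ Submodule.span ℂ ({u, b} : Set (Fin 5 → Fin 5 → ℂ))) (hac : a ∉ Submodule.span ℂ ({u, c} : Set (Fin 5 → Fin 5 → ℂ)))
    (W : Submodule ℂ (Fin 5 → Fin 5 → ℂ))
    (h6 : 6 ≤ Module.finrank ℂ (Submodule.span ℂ ({u, a} : Set (Fin 5 → Fin 5 → ℂ)))
      + Module.finrank ℂ (Submodule.span ℂ ({u, b} : Set (Fin 5 → Fin 5 → ℂ)))
      + Module.finrank ℂ (Submodule.span ℂ ({u, c} : Set (Fin 5 → Fin 5 → ℂ))))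
    (hWs : ∀ μ ∈ W, ∀ s t : Fin 5, μ s t = μ t s) (hWd : ∀ μ ∈ W, ∀ s : Fin 5, μ s s = 0)
    (hWc : ∀ μ ∈ W, contractZ μ ∈ L3 (Submodule.span ℂ ({u, a} : Set (Fin 5 → Fin 5 → ℂ)))
      (Submodule.span ℂ ({u, b} : Set (Fin 5 → Fin 5 → ℂ))) (Submodule.span ℂ ({u, c} : Set (Fin 5 → Fin 5 → ℂ)))) :
    Module.finrank ℂ W ≤ Module.finrank ℂ (Submodule.span ℂ ({u, a} : Set (Fin 5 → Fin 5 → ℂ)))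
      + Module.finrank ℂ (Submodule.span ℂ ({u, b} : Set (Fin 5 → Fin 5 → ℂ)))
      + Module.finrank ℂ (Submodule.span ℂ ({u, c} : Set (Fin 5 → Fin 5 → ℂ))) :=
  (finrank_le_six_of_common_line_three_rows u a b c hu ha hb hc i j p r hij hpi hpj huij hupr hud hab hac W hWs hWd hWc).trans h6


/-- ★★ **`finrank W ≤ 4 + finrank prolong(U₀₁ ⊔ U₀₂)` FOR ANY ZERO-DIAGONAL COMMON LINE** (no third-row hypothesis; in particular for
the pair-monomial line `u = x_i x_j`): ✓ `finrank_le_symDiag_add_prolong_add_diagFree` with `m = 3` (✓ `finrank_symDiag_le_three`) and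
the diagonal-free part of `prolong ⟨u,c⟩` of finrank ≤ 1 (✓ `finrank_diagFree_prolong_pair_le_one`).  So `CaptureIneqSym` holds for three
2-planes through ANY common line as soon as some pair of them has prolongation of finrank ≤ 2 (corollary below); for the pair-monomial
line the located residue is «all three pairwise prolongations ≥ 3». [folklore] -/
theorem finrank_le_four_add_prolong_of_common_line (u a c : Fin 5 → Fin 5 → ℂ) (hu : ∀ p q, u p q = u q p)
    (ha : ∀ p q, a p q = a q p) (hc : ∀ p q, c p q = c q p) (hu0 : u ≠ 0) (hud : ∀ q, u q q = 0)
    (U02 W : Submodule ℂ (Fin 5 → Fin 5 → ℂ)) (h02s : ∀ x ∈ U02, ∀ p q : Fin 5, x p q = x q p) (huU : u ∈ U02) (haU : a ∉ U02)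
    (hWs : ∀ μ ∈ W, ∀ s t : Fin 5, μ s t = μ t s) (hWd : ∀ μ ∈ W, ∀ s : Fin 5, μ s s = 0)
    (hWc : ∀ μ ∈ W, contractZ μ ∈ L3 (Submodule.span ℂ ({u, a} : Set (Fin 5 → Fin 5 → ℂ))) U02
      (Submodule.span ℂ ({u, c} : Set (Fin 5 → Fin 5 → ℂ)))) :
    Module.finrank ℂ W ≤ 4 + Module.finrank ℂ (prolong (Submodule.span ℂ ({u, a} : Set (Fin 5 → Fin 5 → ℂ)) ⊔ U02)) := by
  classical
  have h12s : ∀ x ∈ Submodule.span ℂ ({u, c} : Set (Fin 5 → Fin 5 → ℂ)), ∀ p q : Fin 5, x p q = x q p := by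
    intro x hx p q
    obtain ⟨c1, c2, rfl⟩ := Submodule.mem_span_pair.mp hx
    simp only [Pi.add_apply, Pi.smul_apply, smul_eq_mul, hu p q, hc p q]
  have huU' : u ∈ Submodule.span ℂ ({u, c} : Set (Fin 5 → Fin 5 → ℂ)) := Submodule.subset_span (by simp)
  let ev : Fin 5 → ((Fin 5 → Fin 5 → Fin 5 → ℂ) →ₗ[ℂ] ℂ) := fun q =>
    (LinearMap.proj q).comp ((LinearMap.proj q).comp
      (LinearMap.proj q : (Fin 5 → Fin 5 → Fin 5 → ℂ) →ₗ[ℂ] (Fin 5 → Fin 5 → ℂ)))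
  let D : Submodule ℂ (Fin 5 → Fin 5 → Fin 5 → ℂ) :=
    prolong (Submodule.span ℂ ({u, c} : Set (Fin 5 → Fin 5 → ℂ))) ⊓ ⨅ q : Fin 5, LinearMap.ker (ev q)
  have hDin : ∀ G ∈ prolong (Submodule.span ℂ ({u, c} : Set (Fin 5 → Fin 5 → ℂ))), (∀ q : Fin 5, G q q q = 0) → G ∈ D := by
    intro G hG hG0
    refine Submodule.mem_inf.mpr ⟨hG, ?_⟩
    rw [Submodule.mem_iInf]
    intro q
    rw [LinearMap.mem_ker]
    exact hG0 q
  have hDout : ∀ G ∈ D, G ∈ prolong (Submodule.span ℂ ({u, c} : Set (Fin 5 → Fin 5 → ℂ))) ∧ ∀ q : Fin 5, G q q q = 0 := by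
    intro G hG
    obtain ⟨hG1, hG2⟩ := Submodule.mem_inf.mp hG
    rw [Submodule.mem_iInf] at hG2
    exact ⟨hG1, fun q => by have := hG2 q; rwa [LinearMap.mem_ker] at this⟩
  have hD1 : Module.finrank ℂ D ≤ 1 := finrank_diagFree_prolong_pair_le_one u c hu hc hud hu0 D hDout
  have h := finrank_le_symDiag_add_prolong_add_diagFree u a hu ha U02 _ W h02s h12s hud huU huU' haU 3
    (fun S hS => finrank_symDiag_le_three u hu hu0 S hS) hWs hWd hWc D hDin
  omega

/-- ★ **`CaptureIneqSym` for three 2-planes through ANY common line when some pair has prolongation ≤ 2** (labels chosen so that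
the pair is `⟨u,a⟩, U₀₂`; `6 ≤ Σ finrank`). [folklore] -/
theorem captureIneqSym_of_common_line_of_prolong_le_two (u a c : Fin 5 → Fin 5 → ℂ) (hu : ∀ p q, u p q = u q p)
    (ha : ∀ p q, a p q = a q p) (hc : ∀ p q, c p q = c q p) (hu0 : u ≠ 0) (hud : ∀ q, u q q = 0)
    (U02 W : Submodule ℂ (Fin 5 → Fin 5 → ℂ)) (h02s : ∀ x ∈ U02, ∀ p q : Fin 5, x p q = x q p) (huU : u ∈ U02) (haU : a ∉ U02)
    (h2 : Module.finrank ℂ (prolong (Submodule.span ℂ ({u, a} : Set (Fin 5 → Fin 5 → ℂ)) ⊔ U02)) ≤ 2)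
    (h6 : 6 ≤ Module.finrank ℂ (Submodule.span ℂ ({u, a} : Set (Fin 5 → Fin 5 → ℂ))) + Module.finrank ℂ U02
      + Module.finrank ℂ (Submodule.span ℂ ({u, c} : Set (Fin 5 → Fin 5 → ℂ))))
    (hWs : ∀ μ ∈ W, ∀ s t : Fin 5, μ s t = μ t s) (hWd : ∀ μ ∈ W, ∀ s : Fin 5, μ s s = 0)
    (hWc : ∀ μ ∈ W, contractZ μ ∈ L3 (Submodule.span ℂ ({u, a} : Set (Fin 5 → Fin 5 → ℂ))) U02
      (Submodule.span ℂ ({u, c} : Set (Fin 5 → Fin 5 → ℂ)))) :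
    Module.finrank ℂ W ≤ Module.finrank ℂ (Submodule.span ℂ ({u, a} : Set (Fin 5 → Fin 5 → ℂ))) + Module.finrank ℂ U02
      + Module.finrank ℂ (Submodule.span ℂ ({u, c} : Set (Fin 5 → Fin 5 → ℂ))) := by
  have h := finrank_le_four_add_prolong_of_common_line u a c hu ha hc hu0 hud U02 W h02s huU haU hWs hWd hWc
  omega

end LaplaceFiveSeparatedCapture

end Summit.ValiantsHypothesis.ValiantsHypothesis.Theorems.RigidityForcesSymmetryRankRigidMinimalRepr
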